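import Literature.NumberTheory.Automorphic.SchwartzBruhatL2Pairing
import HarnessLib

/-!
# Integrability of matrix coefficients `b ↦ ⟨A_b Φ, Ψ⟩ = ∫ (A_b Φ) Ψ̄ dν` on `𝒮(X)` extends from a SPANNING SET to all of `𝒮(X)`

Topic `NumberTheory/Automorphic`; namespace `Literature.NumberTheory.Automorphic.SchwartzBruhat` (continuing `SchwartzBruhatL2Pairing`).
KERNEL only: theorems, no definition, no named fact, no `sorry`.

[Li1992, Thm 2.1 (26)–(27) p. 184] states Rallis' inner product formula — and the absolute convergence of its right-hand side
`∫_{H(𝔸)} ⟨ω(h)φ₁, φ₂⟩ \overline{χ(h)} dh` — for FACTORIZABLE `φ₁, φ₂ ∈ S(X(𝔸))` («we assume `φ₁, φ₂` factorizable; the general case follows by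
linearity»): the pairing `⟨ω(h)φ₁, φ₂⟩ = ∫ (ω(h)φ₁) φ̄₂` is linear in `φ₁`, conjugate-linear in `φ₂`, and the factorizable vectors span.  THIS FILE
is that linearity step, for the tree's Schwartz–Bruhat space `𝒮(X)` (locally constant compactly supported functions, a `ℂ`-submodule of `X → ℂ`)
and the pairing `∫ Φ Ψ̄ dν` of `SchwartzBruhatL2Pairing` (`ν` finite on compact sets):

* §1 sesquilinearity of the pairing: `integral_add_mul_conj`, `integral_smul_mul_conj`, `integral_zero_mul_conj` (in `Φ`), `integral_mul_conj_add`,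
  `integral_mul_conj_smul`, `integral_mul_conj_zero` (in `Ψ`) — each from ★ `integrable_mul_conj`;
* §2 **`integrable_coeff_of_span`** — for ANY family `A_b : 𝒮(X) →ₗ[ℂ] 𝒮(X)` (`b` in a measurable space with a measure `μ_G`) and a set
  `S ⊆ 𝒮(X)` with `span S = ⊤`: if `b ↦ ∫ (A_b Φ) Ψ̄ dν` is `μ_G`-integrable for all `Φ, Ψ ∈ S`, then it is `μ_G`-integrable for ALL `Φ, Ψ ∈ 𝒮(X)`
  (`Submodule.span_induction` twice; `Integrable` is closed under `+` and scalars).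

Written for the cell `hodgecm-mathlib` (FLOOR 0, P4 ∕ E-2 road C: the `hF` row «`b ↦ ⟨ω_f(b)Φ_f, Ψ_f⟩ ∈ L¹(U(J_W)(𝔸_{F,f}))` for general
`Φ_f, Ψ_f`» from the pure tensors `⊗_v Φ_v`, which span by ★ `span_range_piProdSB`); nothing here is specific to that consumer.

## References
* [Li1992] J.-S. Li, J. reine angew. Math. 428 (1992), Thm 2.1 (26)–(27) p. 184.
* [Weil1964] A. Weil, *Sur certains groupes d'opérateurs unitaires*, Acta Math. 111 (1964), Chap. I n° 11 (the pairing on `𝒮(X) ⊂ L²(X)`).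
-/

set_option autoImplicit false

noncomputable section

open MeasureTheory
open scoped ComplexConjugate

namespace Literature.NumberTheory.Automorphic

namespace SchwartzBruhat

variable {X : Type*} [TopologicalSpace X] [MeasurableSpace X] [OpensMeasurableSpace X] (ν : Measure X)
  [IsFiniteMeasureOnCompacts ν]

/-! ## §1 Sesquilinearity of `(Φ, Ψ) ↦ ∫ Φ Ψ̄ dν` -/

/-- additivity in the first slot: `∫ (Φ₁ + Φ₂) Ψ̄ = ∫ Φ₁ Ψ̄ + ∫ Φ₂ Ψ̄`. [cite: Weil1964, Chap. I n° 11] -/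
theorem integral_add_mul_conj (Φ₁ Φ₂ Ψ : SchwartzBruhat X) :
    ∫ x, ((Φ₁ + Φ₂ : SchwartzBruhat X) : X → ℂ) x * conj (((Ψ : SchwartzBruhat X) : X → ℂ) x) ∂ν =
      (∫ x, ((Φ₁ : SchwartzBruhat X) : X → ℂ) x * conj (((Ψ : SchwartzBruhat X) : X → ℂ) x) ∂ν) +
        ∫ x, ((Φ₂ : SchwartzBruhat X) : X → ℂ) x * conj (((Ψ : SchwartzBruhat X) : X → ℂ) x) ∂ν := by
  rw [← integral_add (integrable_mul_conj ν Φ₁ Ψ) (integrable_mul_conj ν Φ₂ Ψ)]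
  refine integral_congr_ae (Filter.Eventually.of_forall fun x => ?_)
  simp only [Submodule.coe_add, Pi.add_apply, add_mul]

omit [OpensMeasurableSpace X] [IsFiniteMeasureOnCompacts ν] in
/-- homogeneity in the first slot: `∫ (a • Φ) Ψ̄ = a ∫ Φ Ψ̄`. [cite: Weil1964, Chap. I n° 11] -/
theorem integral_smul_mul_conj (a : ℂ) (Φ Ψ : SchwartzBruhat X) :
    ∫ x, ((a • Φ : SchwartzBruhat X) : X → ℂ) x * conj (((Ψ : SchwartzBruhat X) : X → ℂ) x) ∂ν =
      a * ∫ x, ((Φ : SchwartzBruhat X) : X → ℂ) x * conj (((Ψ : SchwartzBruhat X) : X → ℂ) x) ∂ν := by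
  rw [← integral_const_mul]
  refine integral_congr_ae (Filter.Eventually.of_forall fun x => ?_)
  simp only [Submodule.coe_smul, Pi.smul_apply, smul_eq_mul, mul_assoc]

omit [OpensMeasurableSpace X] [IsFiniteMeasureOnCompacts ν] in
/-- `∫ 0 · Ψ̄ = 0`. [cite: Weil1964, Chap. I n° 11] -/
theorem integral_zero_mul_conj (Ψ : SchwartzBruhat X) :
    ∫ x, ((0 : SchwartzBruhat X) : X → ℂ) x * conj (((Ψ : SchwartzBruhat X) : X → ℂ) x) ∂ν = 0 := by
  simp only [ZeroMemClass.coe_zero, Pi.zero_apply, zero_mul, integral_zero]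

/-- additivity in the second slot: `∫ Φ (Ψ₁ + Ψ₂)‾ = ∫ Φ Ψ̄₁ + ∫ Φ Ψ̄₂`. [cite: Weil1964, Chap. I n° 11] -/
theorem integral_mul_conj_add (Φ Ψ₁ Ψ₂ : SchwartzBruhat X) :
    ∫ x, ((Φ : SchwartzBruhat X) : X → ℂ) x * conj (((Ψ₁ + Ψ₂ : SchwartzBruhat X) : X → ℂ) x) ∂ν =
      (∫ x, ((Φ : SchwartzBruhat X) : X → ℂ) x * conj (((Ψ₁ : SchwartzBruhat X) : X → ℂ) x) ∂ν) +
        ∫ x, ((Φ : SchwartzBruhat X) : X → ℂ) x * conj (((Ψ₂ : SchwartzBruhat X) : X → ℂ) x) ∂ν := by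
  rw [← integral_add (integrable_mul_conj ν Φ Ψ₁) (integrable_mul_conj ν Φ Ψ₂)]
  refine integral_congr_ae (Filter.Eventually.of_forall fun x => ?_)
  simp only [Submodule.coe_add, Pi.add_apply, map_add, mul_add]

omit [OpensMeasurableSpace X] [IsFiniteMeasureOnCompacts ν] in
/-- conjugate-homogeneity in the second slot: `∫ Φ (a • Ψ)‾ = ā ∫ Φ Ψ̄`. [cite: Weil1964, Chap. I n° 11] -/
theorem integral_mul_conj_smul (a : ℂ) (Φ Ψ : SchwartzBruhat X) :
    ∫ x, ((Φ : SchwartzBruhat X) : X → ℂ) x * conj (((a • Ψ : SchwartzBruhat X) : X → ℂ) x) ∂ν =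
      conj a * ∫ x, ((Φ : SchwartzBruhat X) : X → ℂ) x * conj (((Ψ : SchwartzBruhat X) : X → ℂ) x) ∂ν := by
  rw [← integral_const_mul]
  refine integral_congr_ae (Filter.Eventually.of_forall fun x => ?_)
  simp only [Submodule.coe_smul, Pi.smul_apply, smul_eq_mul, map_mul, mul_left_comm]

omit [OpensMeasurableSpace X] [IsFiniteMeasureOnCompacts ν] in
/-- `∫ Φ · 0̄ = 0`. [cite: Weil1964, Chap. I n° 11] -/
theorem integral_mul_conj_zero (Φ : SchwartzBruhat X) :
    ∫ x, ((Φ : SchwartzBruhat X) : X → ℂ) x * conj (((0 : SchwartzBruhat X) : X → ℂ) x) ∂ν = 0 := by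
  simp only [ZeroMemClass.coe_zero, Pi.zero_apply, map_zero, mul_zero, integral_zero]

/-! ## §2 Integrability of `b ↦ ∫ (A_b Φ) Ψ̄` from a spanning set -/

/-- **INTEGRABILITY OF MATRIX COEFFICIENTS FROM A SPANNING SET.**  Let `A_b : 𝒮(X) →ₗ[ℂ] 𝒮(X)` be any family of linear operators indexed by a
measurable space carrying a measure `μ_G`, and `S ⊆ 𝒮(X)` with `span_ℂ S = ⊤`.  If `b ↦ ∫ (A_b Φ) Ψ̄ dν` is `μ_G`-integrable for all `Φ, Ψ ∈ S`, then
it is `μ_G`-integrable for ALL `Φ, Ψ ∈ 𝒮(X)` — the pairing is linear in `Φ` (through `A_b`) and conjugate-linear in `Ψ`, and integrable functions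
form a subspace («the general case follows from the factorizable one by linearity», [Li1992, Thm 2.1]).
[cite: Li1992, Thm 2.1 (26)–(27) p. 184] [cite: Weil1964, Chap. I n° 11] -/
theorem integrable_coeff_of_span {G : Type*} [MeasurableSpace G] (μG : Measure G)
    (A : G → (SchwartzBruhat X →ₗ[ℂ] SchwartzBruhat X)) (S : Set (SchwartzBruhat X)) (hS : Submodule.span ℂ S = ⊤)
    (h : ∀ Φ ∈ S, ∀ Ψ ∈ S, Integrable (fun b : G =>
      ∫ x, ((A b Φ : SchwartzBruhat X) : X → ℂ) x * conj (((Ψ : SchwartzBruhat X) : X → ℂ) x) ∂ν) μG)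
    (Φ Ψ : SchwartzBruhat X) :
    Integrable (fun b : G =>
      ∫ x, ((A b Φ : SchwartzBruhat X) : X → ℂ) x * conj (((Ψ : SchwartzBruhat X) : X → ℂ) x) ∂ν) μG := by
  -- first slot: for `Ψ ∈ S`, every `Θ ∈ span S = 𝒮(X)`
  have step : ∀ Ψ' ∈ S, ∀ Θ : SchwartzBruhat X, Integrable (fun b : G =>
      ∫ x, ((A b Θ : SchwartzBruhat X) : X → ℂ) x * conj (((Ψ' : SchwartzBruhat X) : X → ℂ) x) ∂ν) μG := by
    intro Ψ' hΨ' Θ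
    have hΘ : Θ ∈ Submodule.span ℂ S := by
      rw [hS]
      exact Submodule.mem_top
    induction hΘ using Submodule.span_induction with
    | mem Θ hΘ => exact h Θ hΘ Ψ' hΨ'
    | zero =>
      have h0 : (fun b : G => ∫ x, ((A b 0 : SchwartzBruhat X) : X → ℂ) x * conj (((Ψ' : SchwartzBruhat X) : X → ℂ) x) ∂ν) =
          fun _ => 0 := by
        funext b
        rw [map_zero, integral_zero_mul_conj]
      rw [h0]
      exact integrable_zero _ _ _
    | add Θ₁ Θ₂ _ _ h₁ h₂ =>
      have hadd : (fun b : G => ∫ x, ((A b (Θ₁ + Θ₂) : SchwartzBruhat X) : X → ℂ) x *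
            conj (((Ψ' : SchwartzBruhat X) : X → ℂ) x) ∂ν) =
          fun b => (∫ x, ((A b Θ₁ : SchwartzBruhat X) : X → ℂ) x * conj (((Ψ' : SchwartzBruhat X) : X → ℂ) x) ∂ν) +
            ∫ x, ((A b Θ₂ : SchwartzBruhat X) : X → ℂ) x * conj (((Ψ' : SchwartzBruhat X) : X → ℂ) x) ∂ν := by
        funext b
        rw [map_add, integral_add_mul_conj]
      rw [hadd]
      exact h₁.add h₂
    | smul a Θ _ h₁ =>
      have hsmul : (fun b : G => ∫ x, ((A b (a • Θ) : SchwartzBruhat X) : X → ℂ) x *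
            conj (((Ψ' : SchwartzBruhat X) : X → ℂ) x) ∂ν) =
          fun b => a * ∫ x, ((A b Θ : SchwartzBruhat X) : X → ℂ) x * conj (((Ψ' : SchwartzBruhat X) : X → ℂ) x) ∂ν := by
        funext b
        rw [map_smul, integral_smul_mul_conj]
      rw [hsmul]
      exact h₁.const_mul a
  -- second slot: `Ψ ∈ span S = 𝒮(X)`
  have hΨ : Ψ ∈ Submodule.span ℂ S := by
    rw [hS]
    exact Submodule.mem_top
  induction hΨ using Submodule.span_induction with
  | mem Ψ hΨ => exact step Ψ hΨ Φ
  | zero =>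
    have h0 : (fun b : G => ∫ x, ((A b Φ : SchwartzBruhat X) : X → ℂ) x * conj (((0 : SchwartzBruhat X) : X → ℂ) x) ∂ν) =
        fun _ => 0 := by
      funext b
      rw [integral_mul_conj_zero]
    rw [h0]
    exact integrable_zero _ _ _
  | add Ψ₁ Ψ₂ _ _ h₁ h₂ =>
    have hadd : (fun b : G => ∫ x, ((A b Φ : SchwartzBruhat X) : X → ℂ) x * conj (((Ψ₁ + Ψ₂ : SchwartzBruhat X) : X → ℂ) x) ∂ν) =
        fun b => (∫ x, ((A b Φ : SchwartzBruhat X) : X → ℂ) x * conj (((Ψ₁ : SchwartzBruhat X) : X → ℂ) x) ∂ν) +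
          ∫ x, ((A b Φ : SchwartzBruhat X) : X → ℂ) x * conj (((Ψ₂ : SchwartzBruhat X) : X → ℂ) x) ∂ν := by
      funext b
      rw [integral_mul_conj_add]
    rw [hadd]
    exact h₁.add h₂
  | smul a Ψ _ h₁ =>
    have hsmul : (fun b : G => ∫ x, ((A b Φ : SchwartzBruhat X) : X → ℂ) x * conj (((a • Ψ : SchwartzBruhat X) : X → ℂ) x) ∂ν) =
        fun b => conj a * ∫ x, ((A b Φ : SchwartzBruhat X) : X → ℂ) x * conj (((Ψ : SchwartzBruhat X) : X → ℂ) x) ∂ν := by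
      funext b
      rw [integral_mul_conj_smul]
    rw [hsmul]
    exact h₁.const_mul (conj a)

end SchwartzBruhat

end Literature.NumberTheory.Automorphic

end
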